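import Summits.QuantumFields.BalabanUV.T4Continuum.Support.SubstrateProbesOfRecord
import Summits.QuantumFields.BalabanUV.T4Continuum.Support.SubstrateTransporterSpeciesAnalytic

/-!
# SUBSTRATE — JUNCTION: the single-cube probes on the tagged chart sort (`cubeProbesC`, p221928) AT THE D-8 CHART SPACE
# `V := TowerData P o`, fed by the analyticity of record of the chart-read covariance species (p221513 ∕ p221143) —
# `Probes.Analytic` and `ChartAnalytic` for species-built term families, with the radius from the regular set (MAP v0.6 §4 p1 (1))

Cell `pub-balaban`, SUBSTRATE cell, seat `b2b-balaban-substrate-p1` (gen 2).  Summits-side under the LEAN PLACEMENT RULE.  HONEST FRAMING: rung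
(B)+1 of the FINITE-VOLUME T⁴ programme — NOT infinite volume, NOT a mass gap, NOT Clay; spine PROVED 0∕9; NE4 ∕ NE9 NOT proved.  BOOKKEEPING
ONLY: this file only COMPOSES `SubstrateProbesOfRecord` §6 (`cubeProbesC`, `tagSlice_mem_analytic_cubeProbesC_iff`, `chartAnalytic_cubeProbesC_iff`)
with `SubstrateTransporterSpeciesAnalytic` §4 (`analyticOnNhd_covAtT_expChart`) ∕ `SubstrateTransporterSpeciesHolo` §4 (`regularSet`,
`exists_ball_subset_regularSet`) at the chart space of [dict] D-8, so that the two imports' cones stay separate for every other consumer.  Which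
term family NE4's functional of record reads, which background per run, and the non-vanishing input of Q-S2 are the NE4 owner's (t4-ne4-p1);
nothing printed is asserted ([Balaban1987RG1] (1.17)–(1.22), (4.4) KIND only).
HONEST DEPENDENCY (cell line, verbatim): continuum YM on T⁴ ⇐ BetaPertH ∧ nine spine estimates (0/9 proved); BetaPertH ⇐ (D1) ∧ (D4) ∧
CAP+tail; G-an2-4 gates asym, D1 and NE2/3/4.

WHAT.  `tagSlice_mem_analytic_cubeProbesC_of_regularSet` (term families analytic on the regular set ⇒ in `Probes.Analytic ρ` for SOME `ρ > 0`
when the centre is regular — one ρ for all steps and probes, since all probes read the same chart), `chartAnalytic_cubeProbesC_of_regularSet`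
(the displayed face on the chart sets `S k p := regularSet`), and the SPECIES-ENTRY families `covEntryFamily` (one entry of `covAtT` per probe,
letter tables `kOf ∕ bOf ∕ b′Of`): `analyticOnNhd_covEntryFamily`, **`covEntryFamily_mem_analytic`**, `chartAnalytic_covEntryFamily` — non-vacuity
of NE4 L3's `hAan` on the substrate's objects modulo the DISPLAYED regular centre (J-road).  Imports p221928 + p221513; modifies nothing.
-/

noncomputable section

open scoped BigOperators Matrix Matrix.Norms.L2Operator

namespace Summit.QuantumFields.BalabanUV.T4Continuum.SubstrateProbesChart

open Literature.MathematicalPhysics.QuantumFieldTheory.Balaban1983to89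
open Literature.MathematicalPhysics.QuantumFieldTheory.Balaban1983to89.B5Prop11Plancherel (Tor fine)
open Literature.MathematicalPhysics.QuantumFieldTheory.Balaban1983to89.B5G183RateUnitTower (lev)
open Literature.MathematicalPhysics.QuantumFieldTheory.Balaban1983to89.T4BetaReadOutLipschitz (Probes tagSlice)
open Summit.QuantumFields.BalabanUV.T4Continuum.CovariantBlockAveraging (ContourSystem)
open Summit.QuantumFields.BalabanUV.T4Continuum.B13Carriers (TwoRuns)
open Summit.QuantumFields.BalabanUV.T4Continuum.SubstrateBackgroundTransporters (unitMod)
open Summit.QuantumFields.BalabanUV.T4Continuum.SubstrateTransporterSpecies (TowerData covAtT)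
open Summit.QuantumFields.BalabanUV.T4Continuum.SubstrateTransporterSpeciesHolo (expChartT expChartInvT regularSet exists_ball_subset_regularSet)
open Summit.QuantumFields.BalabanUV.T4Continuum.SubstrateTransporterSpeciesAnalytic (analyticOnNhd_covAtT_expChart)
open Summit.QuantumFields.BalabanUV.T4Continuum.SubstrateProbesOfRecord

variable {G : Type} [GaugeGroup G] (R : TwoRuns G) (P : Params) {o : Type} [Fintype o] [DecidableEq o]
variable {dirA dirB : ℕ → R.carriers.Dom → TowerData P o} {wt : ℕ → R.carriers.Dom → ℝ}
variable (c : ℂ) (a : ℝ) (Γ : (k : ℕ) → ContourSystem P.d (lev P.L k) (unitMod P)) (R₀ : TowerData P o)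

/-! ## §1 Generic junction: analyticity on the regular set ⇒ the probe classes -/

/-- [folklore] **`Probes.Analytic` FROM THE REGULAR SET**: a complex term family analytic (per single cube) on the regular set of the chart at `R⁰`,
with a regular centre, lies in `(cubeProbesC …).Analytic ρ` for some `ρ > 0` — ONE radius for all steps and probes (all probes read the same
chart); `ρ` from openness, NOT computed. -/
theorem tagSlice_mem_analytic_cubeProbesC_of_regularSet (E : R.carriers.Dom → TowerData P o → ℂ)
    (hE : ∀ p, AnalyticOnNhd ℂ (E p) (regularSet P c a Γ R₀)) (h0 : (0 : TowerData P o) ∈ regularSet P c a Γ R₀) :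
    ∃ ρ > 0, tagSlice E ∈ (cubeProbesC R dirA dirB wt).Analytic ρ := by
  obtain ⟨ρ, hρ, hsub⟩ := exists_ball_subset_regularSet P c a Γ h0
  exact ⟨ρ, hρ, (tagSlice_mem_analytic_cubeProbesC_iff E ρ).2 fun _ p _ => (hE p).mono hsub⟩

/-- [folklore] **`ChartAnalytic` ON THE REGULAR SET**: for a functional stored as the tagged slices of complex families `Ec g`, ℂ-differentiability
of every `Ec g p` on the regular set gives §4's displayed face with chart sets `S k p := regularSet`. -/
theorem chartAnalytic_cubeProbesC_of_regularSet (Ec : (ℕ → ℝ) → R.carriers.Dom → TowerData P o → ℂ) (g : ℕ → ℝ)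
    (hE : ∀ p, DifferentiableOn ℂ (Ec g p) (regularSet P c a Γ R₀)) :
    ChartAnalytic (cubeProbesC R dirA dirB wt) (fun g => tagSlice (Ec g)) g (fun _ _ => regularSet P c a Γ R₀) :=
  (chartAnalytic_cubeProbesC_iff Ec g _).2 fun _ p _ => hE p

/-! ## §2 The species-entry families: one entry of the chart-read covariance per probe -/

variable (s : ℕ → ℂ) {T : Type} (kOf : R.carriers.Dom → ℕ) (tOf : R.carriers.Dom → T)
  (bOf b'Of : R.carriers.Dom → (Tor (unitMod P) × Fin P.d) × o)

/-- [folklore] DATA: the SPECIES-ENTRY term family — at the single cube `p`, the entry `(kOf p, tOf p, bOf p, b′Of p)` of the covariance family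
`covAtT` read along the tower chart at `R⁰` (letter tables `kOf ∕ tOf ∕ bOf ∕ b′Of` displayed; a MODEL family for non-vacuity, not NE4's
functional of record). -/
def covEntryFamily : R.carriers.Dom → TowerData P o → ℂ :=
  fun p A => covAtT P c a s Γ (expChartT P R₀ A) (expChartInvT P R₀ A) (kOf p) (tOf p) (bOf p) (b'Of p)

/-- [folklore] Every species-entry family is analytic on the regular set (p221513 `analyticOnNhd_covAtT_expChart` BY NAME). -/
theorem analyticOnNhd_covEntryFamily (p : R.carriers.Dom) :
    AnalyticOnNhd ℂ (covEntryFamily R P c a Γ R₀ s kOf tOf bOf b'Of p) (regularSet P c a Γ R₀) :=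
  analyticOnNhd_covAtT_expChart P c a Γ s R₀ (kOf p) (tOf p) (bOf p) (b'Of p)

/-- [folklore] **NON-VACUITY OF NE4 L3's `hAan` ON THE SUBSTRATE'S OBJECTS**: with a regular centre (DISPLAYED — J-road, `zero_mem_regularSet_towerDataOf`
at the background of record), the tagged slice of every species-entry family lies in `(cubeProbesC …).Analytic ρ` for some `ρ > 0`. -/
theorem covEntryFamily_mem_analytic (h0 : (0 : TowerData P o) ∈ regularSet P c a Γ R₀) :
    ∃ ρ > 0, tagSlice (covEntryFamily R P c a Γ R₀ s kOf tOf bOf b'Of) ∈ (cubeProbesC R dirA dirB wt).Analytic ρ :=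
  tagSlice_mem_analytic_cubeProbesC_of_regularSet R P c a Γ R₀ _ (analyticOnNhd_covEntryFamily R P c a Γ R₀ s kOf tOf bOf b'Of) h0

/-- [folklore] The displayed face `ChartAnalytic` for (coupling-indexed) species-entry families on the regular set — no centre hypothesis needed. -/
theorem chartAnalytic_covEntryFamily (sg : (ℕ → ℝ) → ℕ → ℂ) (g : ℕ → ℝ) :
    ChartAnalytic (cubeProbesC R dirA dirB wt) (fun g => tagSlice (covEntryFamily R P c a Γ R₀ (sg g) kOf tOf bOf b'Of)) g
      (fun _ _ => regularSet P c a Γ R₀) :=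
  chartAnalytic_cubeProbesC_of_regularSet R P c a Γ R₀ (fun g => covEntryFamily R P c a Γ R₀ (sg g) kOf tOf bOf b'Of) g
    fun p => (analyticOnNhd_covEntryFamily R P c a Γ R₀ (sg g) kOf tOf bOf b'Of p).differentiableOn

end Summit.QuantumFields.BalabanUV.T4Continuum.SubstrateProbesChart

end
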